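import Summits.Ventures.Crystal3D.Theorems.StickyWulffConstantCoaxialWallLawPlateFoot
import Summits.Ventures.Crystal3D.Theorems.StickyWulffConstantGenericWallFloorTopTerminalSF
import HarnessLib

/-!
# The plate climb: a tilted twin dozen of a FOREIGN frame below the top sample is joined, up its
# coherent plate, to an unsaturated ball

HONEST FRAMING. Venture `Summits/Ventures/Crystal3D` (cell `crystal3d-full`), helper for the crux
`GenericWallFloor` (stmt-Ventures-19480) of `route-Ventures-StickyWulffConstant`, REGISTERED line `WallLedgerG`,
open stub `stub_twoSlabAdhesion` (general fillings).  Brick for the `Σ3ⁿ` CHAIN PAIRS (the one family left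
out by `general_twoSlabAdhesion_nonTriadic_sf`): there the coherent tube walk of ARCH v4 may ARRIVE in the
top window in the top grain's frame; the last frame change on the way that enters the horizontal class of the
top lattice is a TILTED `{111}` mirror at a twin-dozen ball, and this file turns that ball into a payer at
distance `O(1 + h)` — the mirror image (top sample, foreign plate frame) of 19481-p1's
`twinDozen_plateFoot_payer`.  Rung credit only; F-C1 not moved.

**Theorem (`twinDozen_plateClimb_payer`).**  Top sample `P₂ ⊆ X` of the grain `Λ₂ = A₂·Λ₀ + t₂` complete
on `[h + R₀, h + 2R₀] × disc ρ` (`R₀ ≥ 3`), `X` `1`-separated with ceiling `h + 2R₀`; inputs `KissingGap δ`,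
`KissingClassification δ` BY NAME (through `twinDozen_inPlane_propagate`).  Let `e ∈ X`, `e₂ < h + R₀ + 2`, be
a TWIN DOZEN for a frame `G` with `G(Λ₀) ≠ A₂(Λ₀)` and a unit menu normal `n` (own nine slots occupied, far
three empty) whose plate is NOT horizontal: `0 < δ₀ ≤ (√3/2)·√(1 − ⟪n, e₃⟫²)`; let `K : ℕ` with
`h + R₀ + 2 − e₂ ≤ K·δ₀` and `e` at lateral radius `≤ ρ − K − 3`.  Then there are a unit vector `d` (an
ascending in-plane slot `G(uⱼ − uᵢ)` of the plate), a step count `k ≤ K` with all the balls `e + j·d`,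
`j ≤ k`, in `X`, and an UNSATURATED ball `z ∈ X` (`deg z ≠ 12`) with `z = e + k·d ∨ dist (e + k·d) z = 1`,
at heights `e₂ ≤ (e + k·d)₂ < h + R₀ + 3`.
Mechanism: climb the plate along the ascending in-plane slot (`exists_descent_farDiff`, reversed); a twin
dozen of the plate deep in the top window (`≥ h + R₀ + 2`) is impossible, because its three own polar slots
`−u₁, −u₂, −u₃` are exact `G`-slot neighbours and `movedFcc_eq_of_exact_neighbours_top_sf` would force
`G(Λ₀) = A₂(Λ₀)`; so the twin-dozen structure is lost at some step `≤ K`, and there terrace propagation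
(contrapositive) exhibits an unsaturated ball within contact distance one.

WHAT THIS IS NOT: no counting (the map arrival ↦ payer has fibres `O(K)`, next files); not the stub; F-C1 not
moved.
-/

noncomputable section

namespace Summit.Ventures.Crystal3D.Theorems

open Summit.Ventures.Crystal3D Finset
open Literature.MathematicalPhysics.StatisticalMechanics (fccStacking)
open scoped InnerProductSpace

set_option maxHeartbeats 400000 in
open scoped Classical in
/-- **The plate climb.**  See the module docstring. -/
theorem twinDozen_plateClimb_payer {δ : ℝ} (hg : KissingGap δ) (hc : KissingClassification δ)
    (A₂ : EuclideanSpace ℝ (Fin 3) ≃ₗᵢ[ℝ] EuclideanSpace ℝ (Fin 3)) (t₂ : EuclideanSpace ℝ (Fin 3))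
    (X P₂ : Finset (EuclideanSpace ℝ (Fin 3))) (R₀ h ρ : ℝ) (hR₀ : 3 ≤ R₀) (hρ : R₀ ≤ ρ)
    (hX : ∀ p ∈ X, ∀ q ∈ X, p ≠ q → 1 ≤ dist p q) (hP₂X : P₂ ⊆ X)
    (hcell : ∀ p ∈ X, p 2 ≤ h + 2 * R₀)
    (hP₂ : ∀ p, p ∈ P₂ ↔ (p ∈ (fun q => A₂ q + t₂) '' fccStacking 1 (Real.sqrt (2 / 3)) ∧
      h + R₀ ≤ p 2 ∧ p 2 ≤ h + 2 * R₀ ∧ p 0 ^ 2 + p 1 ^ 2 ≤ ρ ^ 2))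
    (G : EuclideanSpace ℝ (Fin 3) ≃ₗᵢ[ℝ] EuclideanSpace ℝ (Fin 3))
    (hG : G '' fccStacking 1 (Real.sqrt (2 / 3)) ≠ A₂ '' fccStacking 1 (Real.sqrt (2 / 3)))
    {n : EuclideanSpace ℝ (Fin 3)} (hn : ‖n‖ = 1)
    (hmenu : ∀ w ∈ fccSlots, ⟪G w, n⟫_ℝ = 0 ∨ ⟪G w, n⟫_ℝ = Real.sqrt (2 / 3) ∨ ⟪G w, n⟫_ℝ = -Real.sqrt (2 / 3))
    {δ₀ : ℝ} (hδ₀ : 0 < δ₀)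
    (hδ : δ₀ ≤ Real.sqrt 3 / 2 * Real.sqrt (1 - ⟪n, EuclideanSpace.single (2 : Fin 3) (1 : ℝ)⟫_ℝ ^ 2))
    {e : EuclideanSpace ℝ (Fin 3)} (he : e ∈ X) (he₂ : e 2 < h + R₀ + 2)
    (hown : ∀ w ∈ fccSlots, ⟪G w, n⟫_ℝ ≤ 0 → e + G w ∈ X)
    (hfar : ∀ w ∈ fccSlots, 0 < ⟪G w, n⟫_ℝ → e + G w ∉ X)
    (K : ℕ) (hK : h + R₀ + 2 - e 2 ≤ K * δ₀) (her : e 0 ^ 2 + e 1 ^ 2 ≤ (ρ - K - 3) ^ 2)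
    (hρK : (K : ℝ) + 3 ≤ ρ) :
    ∃ d : EuclideanSpace ℝ (Fin 3), ‖d‖ = 1 ∧ ∃ k : ℕ, k ≤ K ∧
      (∀ j : ℕ, j ≤ k → e + (j : ℝ) • d ∈ X) ∧
      ∃ z ∈ X, (X.filter fun q => dist z q = 1).card ≠ 12 ∧
        (z = e + (k : ℝ) • d ∨ dist (e + (k : ℝ) • d) z = 1) ∧
        e 2 ≤ (e + (k : ℝ) • d) 2 ∧ (e + (k : ℝ) • d) 2 < h + R₀ + 3 := by
  have hrpos : 0 < Real.sqrt (2 / 3) := Real.sqrt_pos.2 (by norm_num)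
  obtain ⟨uᵢ, hi, uⱼ, hj, hij, hipos, hjpos, hdesc⟩ := exists_descent_farDiff G hn hmenu
  -- the ascending in-plane slot `d = G (uⱼ − uᵢ)`
  obtain ⟨d, hd⟩ : ∃ d : EuclideanSpace ℝ (Fin 3), d = G (uⱼ - uᵢ) := ⟨_, rfl⟩
  have iij : ⟪uᵢ, uⱼ⟫_ℝ = 1 / 2 := inner_eq_half_of_pos_pos G hn hmenu hi hj hij hipos hjpos
  have iji : ⟪uⱼ, uᵢ⟫_ℝ = 1 / 2 := by rw [real_inner_comm]; exact iij
  have hslot : uⱼ - uᵢ ∈ fccSlots := sub_mem_fccSlots_of_inner_eq_half hj hi iji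
  have hσ : δ₀ ≤ ⟪d, EuclideanSpace.single (2 : Fin 3) (1 : ℝ)⟫_ℝ := by
    have e1 : G (uⱼ - uᵢ) = -G (uᵢ - uⱼ) := by rw [← map_neg, neg_sub]
    rw [hd, e1, inner_neg_left]; linarith
  have hσ1 : ⟪d, EuclideanSpace.single (2 : Fin 3) (1 : ℝ)⟫_ℝ ≤ 1 := by
    rw [hd]; exact (abs_le.1 (abs_inner_slot_le_one G hslot)).2
  have hdn : ⟪d, n⟫_ℝ = 0 := by
    have vi : ⟪G uᵢ, n⟫_ℝ = Real.sqrt (2 / 3) := by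
      rcases hmenu uᵢ hi with h | h | h <;> [linarith; exact h; linarith]
    have vj : ⟪G uⱼ, n⟫_ℝ = Real.sqrt (2 / 3) := by
      rcases hmenu uⱼ hj with h | h | h <;> [linarith; exact h; linarith]
    rw [hd, map_sub, inner_sub_left, vi, vj, sub_self]
  have hdnorm : ‖d‖ = 1 := by rw [hd, LinearIsometryEquiv.norm_map, norm_eq_one_of_mem_fccSlots hslot]
  -- the far frame and the three own polar slots `−u₁, −u₂, −u₃`
  obtain ⟨u₁, hu₁, u₂, hu₂, u₃, hu₃, hn₁, hn₂, hn₃, i12, i13, i23, -, -⟩ := exists_far_frame G hn hmenu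
  have hind : LinearIndependent ℝ ![-u₁, -u₂, -u₃] :=
    linearIndependent_of_pairwise_half (neg_mem_fccSlots hu₁) (neg_mem_fccSlots hu₂) (neg_mem_fccSlots hu₃)
      (by rw [inner_neg_left, inner_neg_right, neg_neg, i12])
      (by rw [inner_neg_left, inner_neg_right, neg_neg, i13])
      (by rw [inner_neg_left, inner_neg_right, neg_neg, i23])
  have hneg₁ : ⟪G (-u₁), n⟫_ℝ ≤ 0 := by rw [map_neg, inner_neg_left, hn₁]; linarith
  have hneg₂ : ⟪G (-u₂), n⟫_ℝ ≤ 0 := by rw [map_neg, inner_neg_left, hn₂]; linarith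
  have hneg₃ : ⟪G (-u₃), n⟫_ℝ ≤ 0 := by rw [map_neg, inner_neg_left, hn₃]; linarith
  -- the walk `y k = e + k • d` and its heights
  obtain ⟨y, hydef⟩ : ∃ y : ℕ → EuclideanSpace ℝ (Fin 3), ∀ k, y k = e + (k : ℝ) • d := ⟨_, fun _ => rfl⟩
  have hy0 : y 0 = e := by rw [hydef]; simp
  have hysucc : ∀ k : ℕ, y (k + 1) = y k + d := by
    intro k; rw [hydef, hydef]; push_cast; rw [add_smul, one_smul, add_assoc]
  have hyh : ∀ k : ℕ, (y k) 2 = e 2 + k * ⟪d, EuclideanSpace.single (2 : Fin 3) (1 : ℝ)⟫_ℝ := by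
    intro k; rw [hydef]; exact apply_two_add_smul e d k
  have hylat : ∀ k : ℕ, k ≤ K → (y k) 0 ^ 2 + (y k) 1 ^ 2 ≤ (ρ - 3) ^ 2 := by
    intro k hk
    have h0 : (0 : ℝ) ≤ ρ - K - 3 := by linarith
    have := lateral_sq_add_le e ((k : ℝ) • d) h0 her
    have hk0 : (0 : ℝ) ≤ k := Nat.cast_nonneg k
    rw [norm_smul, hdnorm, mul_one, Real.norm_eq_abs, abs_of_nonneg hk0] at this
    have hkK : (k : ℝ) ≤ K := by exact_mod_cast hk
    have h1 : (ρ - ↑K - 3 + ↑k) ^ 2 ≤ (ρ - 3) ^ 2 := by nlinarith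
    rw [hydef]; exact this.trans h1
  have hymono : ∀ k : ℕ, e 2 ≤ (y k) 2 := by
    intro k; rw [hyh]
    have : (0 : ℝ) ≤ (k : ℝ) * ⟪d, EuclideanSpace.single (2 : Fin 3) (1 : ℝ)⟫_ℝ :=
      mul_nonneg (Nat.cast_nonneg k) (by linarith)
    linarith
  -- the twin-dozen property along the walk
  obtain ⟨T, hTdef⟩ : ∃ T : ℕ → Prop, ∀ k, T k ↔ (y k ∈ X ∧ (∀ w ∈ fccSlots, ⟪G w, n⟫_ℝ ≤ 0 → y k + G w ∈ X) ∧
      (∀ w ∈ fccSlots, 0 < ⟪G w, n⟫_ℝ → y k + G w ∉ X)) := ⟨_, fun _ => Iff.rfl⟩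
  have hT0 : T 0 := (hTdef 0).2 (by rw [hy0]; exact ⟨he, hown, hfar⟩)
  -- the first `k` at height `≥ h + R₀ + 2`
  have hdeepK : h + R₀ + 2 ≤ (y K) 2 := by
    rw [hyh]
    have h1 : (K : ℝ) * δ₀ ≤ (K : ℝ) * ⟪d, EuclideanSpace.single (2 : Fin 3) (1 : ℝ)⟫_ℝ :=
      mul_le_mul_of_nonneg_left hσ (Nat.cast_nonneg K)
    linarith
  have hexdeep : ∃ k : ℕ, h + R₀ + 2 ≤ (y k) 2 := ⟨K, hdeepK⟩
  obtain ⟨k₁, hk₁def⟩ : ∃ k₁ : ℕ, k₁ = Nat.find hexdeep := ⟨_, rfl⟩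
  have hk₁h : h + R₀ + 2 ≤ (y k₁) 2 := by rw [hk₁def]; exact Nat.find_spec hexdeep
  have hk₁K : k₁ ≤ K := by rw [hk₁def]; exact Nat.find_min' hexdeep hdeepK
  have hbelow : ∀ k : ℕ, k < k₁ → (y k) 2 < h + R₀ + 2 := by
    intro k hk
    have := Nat.find_min hexdeep (by rw [← hk₁def]; exact hk)
    push Not at this; exact this
  have hk₁pos : 0 < k₁ := by
    rcases Nat.eq_zero_or_pos k₁ with h0 | hpos
    · exfalso; rw [h0, hy0] at hk₁h; linarith
    · exact hpos
  -- a twin dozen of the plate is never deep in the top window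
  have hnotT : ¬ T k₁ := by
    intro hTk
    obtain ⟨hyX, hown', -⟩ := (hTdef k₁).1 hTk
    have hlat : (y k₁) 0 ^ 2 + (y k₁) 1 ^ 2 ≤ (ρ - 2) ^ 2 :=
      (hylat k₁ hk₁K).trans (by nlinarith)
    exact hG (movedFcc_eq_of_exact_neighbours_top_sf A₂ t₂ X P₂ R₀ h ρ hR₀ hρ hX hP₂X hcell hP₂ G hyX hk₁h hlat
      (neg_mem_fccSlots hu₁) (neg_mem_fccSlots hu₂) (neg_mem_fccSlots hu₃) hind
      (hown' _ (neg_mem_fccSlots hu₁) hneg₁) (hown' _ (neg_mem_fccSlots hu₂) hneg₂)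
      (hown' _ (neg_mem_fccSlots hu₃) hneg₃))
  -- the first step at which the twin-dozen structure is lost
  have hexbad : ∃ k, ¬ T k := ⟨k₁, hnotT⟩
  obtain ⟨kb, hkbdef⟩ : ∃ kb : ℕ, kb = Nat.find hexbad := ⟨_, rfl⟩
  have hkb_spec : ¬ T kb := by rw [hkbdef]; exact Nat.find_spec hexbad
  have hkb_le : kb ≤ k₁ := by rw [hkbdef]; exact Nat.find_min' hexbad hnotT
  have hkb_pos : 0 < kb := by
    rcases Nat.eq_zero_or_pos kb with h0 | h
    · rw [h0] at hkb_spec; exact absurd hT0 hkb_spec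
    · exact h
  have hTlt : ∀ j : ℕ, j < kb → T j := by
    intro j hj
    have := Nat.find_min hexbad (by rw [← hkbdef]; exact hj)
    push Not at this; exact this
  have hprevT : T (kb - 1) := hTlt _ (Nat.sub_lt hkb_pos Nat.one_pos)
  obtain ⟨hyX, hown', hfar'⟩ := (hTdef (kb - 1)).1 hprevT
  have ekb : kb = (kb - 1) + 1 := (Nat.sub_add_cancel hkb_pos).symm
  have hy' : y kb = y (kb - 1) + G (uⱼ - uᵢ) := by conv_lhs => rw [ekb, hysucc, hd]
  -- the next ball is in `X` (own slot of the twin dozen) but not a twin dozen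
  have hy'X : y kb ∈ X := by
    rw [hy']; exact hown' _ hslot (by rw [← hd, hdn])
  have hnot12 : ¬ ((X.filter fun q => dist (y kb) q = 1).card = 12 ∧
      ∀ z ∈ X, dist (y kb) z = 1 → z ≠ y kb → (X.filter fun q => dist z q = 1).card = 12) := by
    rintro ⟨h12, hnb⟩
    apply hkb_spec
    rw [hy'] at h12 hnb
    obtain ⟨hown'', -, hfar''⟩ := twinDozen_inPlane_propagate hg hc hX G hn hmenu hyX hown' hfar' hj hi hij.symm
      hjpos hipos h12 (y (kb - 1) + G (uⱼ - uᵢ)) hnb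
    refine (hTdef kb).2 ⟨hy'X, ?_, ?_⟩
    · rw [hy']; exact hown''
    · rw [hy']; exact hfar''
  -- the payer
  have hpay : ∃ z ∈ X, (X.filter fun q => dist z q = 1).card ≠ 12 ∧ (z = y kb ∨ dist (y kb) z = 1) := by
    by_cases h12 : (X.filter fun q => dist (y kb) q = 1).card = 12
    · have hnb : ¬ ∀ z ∈ X, dist (y kb) z = 1 → z ≠ y kb → (X.filter fun q => dist z q = 1).card = 12 :=
        fun h => hnot12 ⟨h12, h⟩
      push Not at hnb
      obtain ⟨z, hzX, hdz, -, hz12⟩ := hnb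
      exact ⟨z, hzX, hz12, Or.inr hdz⟩
    · exact ⟨y kb, hy'X, h12, Or.inl rfl⟩
  obtain ⟨z, hzX, hz12, hzy⟩ := hpay
  -- heights of `y kb`
  have hhi : (y kb) 2 < h + R₀ + 3 := by
    have hprev : (y (kb - 1)) 2 < h + R₀ + 2 :=
      hbelow _ (lt_of_lt_of_le (Nat.sub_lt hkb_pos Nat.one_pos) hkb_le)
    have : (y kb) 2 = (y (kb - 1)) 2 + ⟪d, EuclideanSpace.single (2 : Fin 3) (1 : ℝ)⟫_ℝ := by
      conv_lhs => rw [ekb, hysucc]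
      rw [PiLp.add_apply, apply_two_eq_inner_e₃ d]
    rw [this]; linarith
  refine ⟨d, hdnorm, kb, hkb_le.trans hk₁K, ?_, z, hzX, hz12, ?_, ?_, ?_⟩
  · intro j hj
    rcases lt_or_eq_of_le hj with hlt | heq
    · rw [← hydef]; exact ((hTdef j).1 (hTlt j hlt)).1
    · rw [heq, ← hydef]; exact hy'X
  · rw [← hydef]; exact hzy
  · rw [← hydef]; exact hymono kb
  · rw [← hydef]; exact hhi

end Summit.Ventures.Crystal3D.Theorems

end
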